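import Mathlib
import HarnessLib
import Summits.Ventures.LatticeQCDFlow.Exactness.SphereLatticePoincare

/-!
# `L²`-stability of Lüscher's recursion on the lattice of spheres, uniformly in the lattice size: `‖X − X̄‖ ≤ ‖𝔏₀X‖/(d−1)`

HONEST FRAMING: exact (Metropolis-corrected) sampling algorithms for lattice gauge theory;
figures of merit are autocorrelation/cost numbers at stated couplings and volumes; no
continuum-physics claim.

Venture `LatticeQCDFlow` (cell pub-lqcd), topic `Exactness`; FANOUT row 7 (`s0-cpn-null`: the
S0-D1 rung — 2D CP⁹, Lüscher's LO trivializing map inside HMC, Engel–Schaefer 2011).  NEW WORK of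
the cell over Mathlib and the tree's `Exactness/SphereLatticePoincare.lean` (spectral gap `d − 1`
of `𝔏₀ = −Σ_k ∂̃_k·∂̃_k` under the uniform product measure, any finite `Λ`),
`Exactness/SphereLatticeGreen.lean` (`∫ 𝔏₀F = 0`) and `Exactness/LatticeCoordAvg.lean`
(`∫ (h − ∫h)² = ∫ h² − (∫ h)²`); nothing is cited as a fact.  Printed counterpart, NAMED ONLY:
M. Lüscher, Commun. Math. Phys. 293 (2010) 899, §3.3 (invertibility of `𝔏₀` on the orthogonal
complement of the constants, used order by order in the recursion (3.9)–(3.12) for the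
trivializing flow action) — here with the QUANTITATIVE, VOLUME-INDEPENDENT bound for the
CP(N−1)/O(N) site spheres of Engel–Schaefer, Comput. Phys. Commun. 182 (2011) 2107, §3.

## Setting

`𝔼 = ℝ^{m+2}` (`d = m + 2 ≥ 2`; CP(N−1): `d = 2N`), `π = ⊗_Λ σ̄` the uniform probability measure on
the product of unit spheres over a finite `Λ`, `F : (Λ → 𝔼) → ℝ` of class `C²` read through
`n ↦ (ω n : 𝔼)`, `𝔏₀F = −Σ_k ∂̃_k·∂̃_k F` (E–S site Laplacians).

## Content

* `integral_sum_siteLaplacian_pi_uniformSphere` — `∫ Σ_k ∂̃_k·∂̃_k F dπ = 0`.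
* **`variance_le_integral_sq_luscher`** — THE STABILITY ESTIMATE:
  `∫ (F − ∫F dπ)² dπ ≤ (m+1)⁻² · ∫ (Σ_k ∂̃_k·∂̃_k F)² dπ`, i.e.
  `‖F − F̄‖_{L²(π)} ≤ ‖𝔏₀F‖_{L²(π)}/(d − 1)` for every finite `Λ` (gap + Young's inequality).
* **`luscher_recursion_stable`** — for Lüscher's recursion `𝔏₀X = R + c` on the product of unit
  spheres (`X ∈ C²`; the source `R` is then continuous there): the solution's fluctuation is
  controlled by the source's, `Var_π(X) ≤ Var_π(R)/(d−1)²`, uniformly in `|Λ|` — every order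
  `S̃⁽ᵏ⁾` of the flow action is `L²`-bounded by its source with a constant that does not grow with
  the volume.

NOT CLAIMED: pointwise / sup-norm or locality (decay) bounds on `𝔏₀⁻¹`; existence of solutions
beyond the orders constructed in the tree (`S̃⁽⁰⁾`, `S̃⁽¹⁾`); bounds for the interacting measure;
anything about autocorrelations.
-/

noncomputable section

namespace Summit.Ventures.LatticeQCDFlow.Exactness

open NormedSpace Function MeasureTheory Metric InnerProductSpace Laplacian Filter Set
open scoped RealInnerProductSpace Topology Gradient ENNReal

variable {m : ℕ} {Λ : Type*} [Fintype Λ] [DecidableEq Λ]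

/-- **`∫ Σ_k ∂̃_k·∂̃_k F dπ = 0`** under the uniform product probability measure (the range of `𝔏₀`
is orthogonal to the constants; rescaled from `SphereLatticeGreen`). -/
theorem integral_sum_siteLaplacian_pi_uniformSphere {F : (Λ → EuclideanSpace ℝ (Fin (m + 2))) → ℝ}
    (hF : ContDiff ℝ 2 F) :
    ∫ ω, ∑ k, siteLaplacian k F (fun n => (ω n : EuclideanSpace ℝ (Fin (m + 2))))
      ∂Measure.pi (fun _ : Λ => uniformSphere (volume : Measure (EuclideanSpace ℝ (Fin (m + 2))))) =
      0 := by
  rw [integral_pi_uniformSphere, integral_sum_siteLaplacian_eq_zero hF, mul_zero]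

/-- Young's inequality in the form used below: `2·t·(a·b) ≤ t²·a² + b²`. -/
theorem two_mul_mul_mul_le_sq_add_sq (t a b : ℝ) : 2 * t * (a * b) ≤ t ^ 2 * a ^ 2 + b ^ 2 := by
  nlinarith [sq_nonneg (t * a - b)]

/-- **`L²`-STABILITY OF `𝔏₀`, UNIFORMLY IN THE LATTICE SIZE.**  For `F ∈ C²` and every finite `Λ`:
`∫ (F − ∫F dπ)² dπ ≤ (m+1)⁻²·∫ (Σ_k ∂̃_k·∂̃_k F)² dπ`, i.e. `‖F − F̄‖_{L²(π)} ≤ ‖𝔏₀F‖_{L²(π)}/(d−1)`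
with `d − 1 = m + 1` (`= 2N − 1` for CP(N−1)): the spectral gap `(d−1)·Var(F) ≤ ⟨F, 𝔏₀F⟩ =
⟨F − F̄, 𝔏₀F⟩`, then Young's inequality `2(d−1)⟨F − F̄, 𝔏₀F⟩ ≤ (d−1)²‖F − F̄‖² + ‖𝔏₀F‖²`. -/
theorem variance_le_integral_sq_luscher {F : (Λ → EuclideanSpace ℝ (Fin (m + 2))) → ℝ}
    (hF : ContDiff ℝ 2 F) :
    ∫ ω, (F (fun n => (ω n : EuclideanSpace ℝ (Fin (m + 2)))) -
        ∫ ω', F (fun n => (ω' n : EuclideanSpace ℝ (Fin (m + 2))))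
          ∂Measure.pi (fun _ : Λ => uniformSphere (volume : Measure (EuclideanSpace ℝ (Fin (m + 2)))))) ^ 2
      ∂Measure.pi (fun _ : Λ => uniformSphere (volume : Measure (EuclideanSpace ℝ (Fin (m + 2))))) ≤
      (((m : ℝ) + 1) ^ 2)⁻¹ *
        ∫ ω, (∑ k, siteLaplacian k F (fun n => (ω n : EuclideanSpace ℝ (Fin (m + 2))))) ^ 2
          ∂Measure.pi (fun _ : Λ => uniformSphere (volume : Measure (EuclideanSpace ℝ (Fin (m + 2))))) := by
  set μ : Measure (sphere (0 : EuclideanSpace ℝ (Fin (m + 2))) 1) :=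
    uniformSphere (volume : Measure (EuclideanSpace ℝ (Fin (m + 2)))) with hμ
  set G : (Λ → sphere (0 : EuclideanSpace ℝ (Fin (m + 2))) 1) → ℝ :=
    fun ω => F (fun n => (ω n : EuclideanSpace ℝ (Fin (m + 2)))) with hG
  set H : (Λ → sphere (0 : EuclideanSpace ℝ (Fin (m + 2))) 1) → ℝ :=
    fun ω => ∑ k, siteLaplacian k F (fun n => (ω n : EuclideanSpace ℝ (Fin (m + 2)))) with hH
  have hGc : Continuous G := hF.continuous.comp continuous_sphereConfig
  have hHc : Continuous H := continuous_finsetSum Finset.univ fun k _ =>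
    continuous_siteLaplacian_sphereConfig hF k
  set c : ℝ := ∫ ω', G ω' ∂Measure.pi (fun _ : Λ => μ) with hc
  have hm1 : (0 : ℝ) < (m : ℝ) + 1 := by positivity
  -- integrability
  have hiD2 : Integrable (fun ω => (G ω - c) ^ 2) (Measure.pi fun _ : Λ => μ) :=
    integrable_pi_of_continuous μ ((hGc.sub continuous_const).pow 2)
  have hiH2 : Integrable (fun ω => H ω ^ 2) (Measure.pi fun _ : Λ => μ) :=
    integrable_pi_of_continuous μ (hHc.pow 2)
  have hiDH : Integrable (fun ω => (G ω - c) * -H ω) (Measure.pi fun _ : Λ => μ) :=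
    integrable_pi_of_continuous μ ((hGc.sub continuous_const).mul hHc.neg)
  have hiGH : Integrable (fun ω => G ω * -H ω) (Measure.pi fun _ : Λ => μ) :=
    integrable_pi_of_continuous μ (hGc.mul hHc.neg)
  have hiH : Integrable (fun ω => -H ω) (Measure.pi fun _ : Λ => μ) :=
    integrable_pi_of_continuous μ hHc.neg
  -- (1) the gap: `(m+1)·V ≤ ∫ G·(−H)`
  have hgap := lattice_sphere_spectral_gap (Λ := Λ) hF
  rw [← integral_sq_sub_mean μ hGc] at hgap
  -- (2) `∫ G·(−H) = ∫ (G − c)·(−H)` since `∫ H = 0`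
  have hH0 : ∫ ω, H ω ∂Measure.pi (fun _ : Λ => μ) = 0 :=
    integral_sum_siteLaplacian_pi_uniformSphere hF
  have hshift : ∫ ω, G ω * -H ω ∂Measure.pi (fun _ : Λ => μ) =
      ∫ ω, (G ω - c) * -H ω ∂Measure.pi (fun _ : Λ => μ) := by
    have hfun : (fun ω => (G ω - c) * -H ω) = fun ω => G ω * -H ω - c * -H ω := by
      funext ω; ring
    rw [hfun, integral_sub hiGH (hiH.const_mul c), integral_const_mul, integral_neg, hH0, neg_zero,
      mul_zero, sub_zero]
  -- (3) Young: `2(m+1)·∫(G − c)(−H) ≤ (m+1)²·V + ∫ H²`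
  have hyoung : 2 * ((m : ℝ) + 1) * ∫ ω, (G ω - c) * -H ω ∂Measure.pi (fun _ : Λ => μ) ≤
      ((m : ℝ) + 1) ^ 2 * ∫ ω, (G ω - c) ^ 2 ∂Measure.pi (fun _ : Λ => μ) +
        ∫ ω, H ω ^ 2 ∂Measure.pi (fun _ : Λ => μ) := by
    rw [← integral_const_mul, ← integral_const_mul, ← integral_add (hiD2.const_mul _) hiH2]
    refine integral_mono (hiDH.const_mul _) ((hiD2.const_mul _).add hiH2) fun ω => ?_
    have h := two_mul_mul_mul_le_sq_add_sq ((m : ℝ) + 1) (G ω - c) (-H ω)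
    simp only [neg_sq] at h
    exact h
  -- (4) combine
  have hV : ((m : ℝ) + 1) ^ 2 * ∫ ω, (G ω - c) ^ 2 ∂Measure.pi (fun _ : Λ => μ) ≤
      ∫ ω, H ω ^ 2 ∂Measure.pi (fun _ : Λ => μ) := by
    have h1 : ((m : ℝ) + 1) * ∫ ω, (G ω - c) ^ 2 ∂Measure.pi (fun _ : Λ => μ) ≤
        ∫ ω, (G ω - c) * -H ω ∂Measure.pi (fun _ : Λ => μ) := by
      rw [← hshift]; exact hgap
    nlinarith [h1, hyoung, hm1]
  rw [← div_eq_inv_mul, le_div_iff₀ (by positivity), mul_comm]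
  exact hV

/-- **Lüscher's recursion is `L²`-stable, uniformly in the volume.**  If `X ∈ C²` solves
`−Σ_k ∂̃_k·∂̃_k X = R + c` on the product of unit spheres (any order of the recursion
(3.9)–(3.12): `R` the source built from the lower orders, `c` the constant `Ċ`), then
`Var_π(X) ≤ Var_π(R)/(d−1)²`: `∫ (X − ∫X)² dπ ≤ (m+1)⁻² ∫ (R − ∫R)² dπ` for every finite `Λ`. -/
theorem luscher_recursion_stable {X R : (Λ → EuclideanSpace ℝ (Fin (m + 2))) → ℝ}
    (hX : ContDiff ℝ 2 X) {c : ℝ}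
    (hrec : ∀ ω : Λ → sphere (0 : EuclideanSpace ℝ (Fin (m + 2))) 1,
      -∑ k, siteLaplacian k X (fun n => (ω n : EuclideanSpace ℝ (Fin (m + 2)))) =
        R (fun n => (ω n : EuclideanSpace ℝ (Fin (m + 2)))) + c) :
    ∫ ω, (X (fun n => (ω n : EuclideanSpace ℝ (Fin (m + 2)))) -
        ∫ ω', X (fun n => (ω' n : EuclideanSpace ℝ (Fin (m + 2))))
          ∂Measure.pi (fun _ : Λ => uniformSphere (volume : Measure (EuclideanSpace ℝ (Fin (m + 2)))))) ^ 2
      ∂Measure.pi (fun _ : Λ => uniformSphere (volume : Measure (EuclideanSpace ℝ (Fin (m + 2))))) ≤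
      (((m : ℝ) + 1) ^ 2)⁻¹ *
        ∫ ω, (R (fun n => (ω n : EuclideanSpace ℝ (Fin (m + 2)))) -
          ∫ ω', R (fun n => (ω' n : EuclideanSpace ℝ (Fin (m + 2))))
            ∂Measure.pi (fun _ : Λ => uniformSphere (volume : Measure (EuclideanSpace ℝ (Fin (m + 2)))))) ^ 2
          ∂Measure.pi (fun _ : Λ => uniformSphere (volume : Measure (EuclideanSpace ℝ (Fin (m + 2))))) := by
  set μ : Measure (sphere (0 : EuclideanSpace ℝ (Fin (m + 2))) 1) :=
    uniformSphere (volume : Measure (EuclideanSpace ℝ (Fin (m + 2)))) with hμ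
  have h := variance_le_integral_sq_luscher (Λ := Λ) hX
  have hsum : ∀ ω : Λ → sphere (0 : EuclideanSpace ℝ (Fin (m + 2))) 1,
      ∑ k, siteLaplacian k X (fun n => (ω n : EuclideanSpace ℝ (Fin (m + 2)))) =
        -(R (fun n => (ω n : EuclideanSpace ℝ (Fin (m + 2)))) + c) := fun ω => by
    rw [← hrec ω, neg_neg]
  -- the source, read on the product of spheres, is continuous (it is `𝔏₀X − c` there)
  have hRc : Continuous fun ω : Λ → sphere (0 : EuclideanSpace ℝ (Fin (m + 2))) 1 =>
      R (fun n => (ω n : EuclideanSpace ℝ (Fin (m + 2)))) := by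
    have hfun : (fun ω : Λ → sphere (0 : EuclideanSpace ℝ (Fin (m + 2))) 1 =>
        R (fun n => (ω n : EuclideanSpace ℝ (Fin (m + 2))))) = fun ω =>
        -∑ k, siteLaplacian k X (fun n => (ω n : EuclideanSpace ℝ (Fin (m + 2)))) - c := by
      funext ω; rw [hrec ω]; ring
    rw [hfun]
    exact (continuous_finsetSum Finset.univ fun k _ =>
      continuous_siteLaplacian_sphereConfig hX k).neg.sub continuous_const
  -- the source has mean `−c`: `∫ R dπ = −c` (from `∫ 𝔏₀X = 0`)
  have hmean : ∫ ω', R (fun n => (ω' n : EuclideanSpace ℝ (Fin (m + 2)))) ∂Measure.pi (fun _ : Λ => μ) =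
      -c := by
    have h0 := integral_sum_siteLaplacian_pi_uniformSphere (Λ := Λ) hX
    simp_rw [hsum, integral_neg] at h0
    rw [neg_eq_zero, integral_add (integrable_pi_of_continuous μ hRc) (integrable_const c),
      integral_const, smul_eq_mul, Measure.real, measure_univ, ENNReal.toReal_one, one_mul] at h0
    linarith
  simp_rw [hsum] at h
  rw [hmean]
  have hsq : ∀ ω : Λ → sphere (0 : EuclideanSpace ℝ (Fin (m + 2))) 1,
      (-(R (fun n => (ω n : EuclideanSpace ℝ (Fin (m + 2)))) + c)) ^ 2 =
        (R (fun n => (ω n : EuclideanSpace ℝ (Fin (m + 2)))) - -c) ^ 2 := fun ω => by ring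
  simp_rw [hsq] at h
  exact h

end Summit.Ventures.LatticeQCDFlow.Exactness

end
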